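import Literature.AlgebraicGeometry.AbelianSchemes.SerreTensorIdealTranslationKernel
import HarnessLib

/-!
# The quasi-inverse `ψ′ : A ⊗_𝒪 𝔟 ⟶ A` of the ideal translation: `ψ_P ≫ ψ′ = [N]_A`, `ψ′ ≫ ψ_P = [N]_{A ⊗ 𝔟}`

Topic `AlgebraicGeometry/AbelianSchemes`, namespace `Literature.AlgebraicGeometry.AbelianSchemes.AbelianSchemeOver` (one construction with body + proved
theorems; no named fact, no `sorry`, no `instance`, no notation; ANY base scheme `S`).  Cell `hodgecm-mathlib`, F0/P6 «MOD», sequel to ★ (A)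
`SerreTensorIdealTranslationKernel` (p845164) feeding the `hχ` quasi-inverse hypotheses of ★ `AbelianSchemeHomDescentPolarized` (polarised recognition:
`ψ^∨ ≫ χ′ = [M]` from `ψ′ ≫ ψ = [M]` by ★ `dualIsogenyOver_comp` + ★ `dualIsogenyOver_mulN`) and of ★ FILE 14 (`isIsogeny_fibreHom_of_quasiInverse`);
`--supports stmt-HodgeConjecture-24832`, count-neutral.  HC_CM is proved only modulo the 2 remaining named inputs (hLiu418, h413) until rung 0 closes; this file
discharges none of them.

## Mathematics

With a quasi-inverse row `Q` of the column `P` (`QE′ = Q`, `QP = N·1`, `PQ = N·E′` — e.g. multiplication by an integer `N ∈ 𝔭` on `𝔭⁻¹`), the Serre map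
`A ⊗ Q : A ⊗_𝒪 𝔟 → A ⊗_𝒪 𝒪 ≅ A` is a quasi-inverse of `ψ_P`: `ψ_P ≫ ψ′ = ι(N) = [N]_A` and `ψ′ ≫ ψ_P = ι_{A⊗𝔟}(N) = [N]_{A⊗𝔟}` (★ FILE 13
`serrePresentationHom_comp_of_quasiInverse`, ★ `RingAction.i_natCast`) — «`A ⊗ 𝔭⁻¹ → A ⊗ (1∕N)𝔭⁻¹ ⊇ …`», [Conrad2004GrossZagier] §7 Thm. 7.5; [MumfordAV1970]
§7 remark after Thm. 4 (an isogeny with kernel killed by `N` divides `[N]`).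

## Contents

* **`serreTranslateInv act E′ hE′ Q : (serreTensor act E′ hE′).X ⟶ A.X`**, `isMonHom_serreTranslateInv`;
* **`serreTranslate_comp_serreTranslateInv`** (`= act.i N = (𝟙 A.X) ^ N`), **`serreTranslateInv_comp_serreTranslate`** (`= (serreAction …).i N = (𝟙 _) ^ N`);
* `i_comp_serreTranslateInv` (`𝒪`-equivariance of `ψ′`).

## References
* [Conrad2004GrossZagier] B. Conrad, *Gross–Zagier revisited*, MSRI Publ. 49 (2004), §7 (Thm. 7.5).
* [MumfordAV1970] D. Mumford, *Abelian Varieties* (1970), §7 Thm. 4 and the remark following it (p. 72).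
* Tree: ★ `SerreTensorIdealTranslationKernel`, ★ `SerreTensorQuasiInverse` (FILE 13), ★ `SerreTensorIsogeny` (FILE 15).
-/

noncomputable section

universe u

open CategoryTheory CategoryTheory.Limits AlgebraicGeometry MonoidalCategory CartesianMonoidalCategory
open scoped MonObj

namespace Literature.AlgebraicGeometry.AbelianSchemes

namespace AbelianSchemeOver

variable {S : Scheme.{u}} {A : AbelianSchemeOver S} {O : Type*} [CommRing O] (act : A.RingAction O) [IsCommMonObj A.X]
  {m : ℕ} (E' : Matrix (Fin m) (Fin m) O) (hE' : E' * E' = E') (P : Matrix (Fin m) (Fin 1) O) (Q : Matrix (Fin 1) (Fin m) O) {N : ℕ}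

/-- **The quasi-inverse `ψ′ := (A ⊗ Q) ≫ (A ⊗_𝒪 𝒪 ≅ A) : A ⊗_𝒪 𝔟 ⟶ A`** of the ideal translation `ψ_P` (for a row `Q` with `QP = N`, `PQ = N·E′`).
[cite: Conrad2004GrossZagier, §7 (Thm. 7.5)] -/
def serreTranslateInv : (serreTensor act E' hE').X ⟶ A.X :=
  serrePresentationHom act E' hE' (1 : Matrix (Fin 1) (Fin 1) O) one_mul_one_fin_one Q ≫ (serreTensorOneIso act).hom

/-- `ψ′` is a homomorphism. [cite: Conrad2004GrossZagier, §7 (Thm. 7.5)] -/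
theorem isMonHom_serreTranslateInv : IsMonHom (serreTranslateInv act E' hE' Q) := by
  haveI := (isMonHom_serreTensorOneIso act).1
  haveI := isMonHom_serrePresentationHom act E' hE' (1 : Matrix (Fin 1) (Fin 1) O) one_mul_one_fin_one Q
  unfold serreTranslateInv
  infer_instance

/-- **`ψ_P ≫ ψ′ = ι(N) = [N]_A`** (`QP = N`). [cite: Conrad2004GrossZagier, §7 (Thm. 7.5)] [cite: MumfordAV1970, §7 Thm. 4 (p. 72)] -/
theorem serreTranslate_comp_serreTranslateInv (hP : E' * P = P) (hQ : Q * E' = Q) (hQP : Q * P = Matrix.scalar (Fin 1) (N : O)) :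
    serreTranslate act E' hE' P ≫ serreTranslateInv act E' hE' Q = (𝟙 A.X) ^ N := by
  rw [serreTranslate, serreTranslateInv, Category.assoc, ← Category.assoc (serrePresentationHom act 1 _ E' hE' P),
    serrePresentationHom_comp_of_quasiInverse act (1 : Matrix (Fin 1) (Fin 1) O) one_mul_one_fin_one E' hE' P Q
      (by rw [Matrix.mul_one]; exact hP) (by rw [Matrix.one_mul]; exact hQ.symm) (by rw [Matrix.mul_one]; exact hQP),
    serreTensorOneIso_equivariant, Iso.inv_hom_id_assoc, RingAction.i_natCast]

/-- **`ψ′ ≫ ψ_P = ι_{A⊗𝔟}(N) = [N]_{A ⊗ 𝔟}`** (`PQ = N·E′`). [cite: Conrad2004GrossZagier, §7 (Thm. 7.5)] [cite: MumfordAV1970, §7 Thm. 4 (p. 72)] -/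
theorem serreTranslateInv_comp_serreTranslate (hP : E' * P = P) (hQ : Q * E' = Q) (hPQ : P * Q = Matrix.scalar (Fin m) (N : O) * E') :
    serreTranslateInv act E' hE' Q ≫ serreTranslate act E' hE' P = (𝟙 (serreTensor act E' hE').X) ^ N := by
  rw [serreTranslate, serreTranslateInv, Category.assoc, Iso.hom_inv_id_assoc,
    serrePresentationHom_comp_of_quasiInverse act E' hE' (1 : Matrix (Fin 1) (Fin 1) O) one_mul_one_fin_one Q P
      (by rw [Matrix.one_mul]; exact hQ.symm) (by rw [Matrix.mul_one]; exact hP) hPQ,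
    RingAction.i_natCast]

/-- **`𝒪`-equivariance of `ψ′`**: `ι_{A⊗𝔟}(a) ≫ ψ′ = ψ′ ≫ ι(a)`. [cite: Conrad2004GrossZagier, §7 (Thm. 7.5)] -/
theorem i_comp_serreTranslateInv (hQ : Q * E' = Q) (a : O) :
    (serreAction act E' hE').i a ≫ serreTranslateInv act E' hE' Q = serreTranslateInv act E' hE' Q ≫ act.i a := by
  rw [serreTranslateInv, ← Category.assoc,
    serreAction_comp_serrePresentationHom_of act E' hE' (1 : Matrix (Fin 1) (Fin 1) O) one_mul_one_fin_one Q
      (by rw [Matrix.one_mul]; exact hQ.symm),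
    Category.assoc, serreTensorOneIso_equivariant, Category.assoc]

end AbelianSchemeOver

end Literature.AlgebraicGeometry.AbelianSchemes

end
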